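import Summits.RiemannHypothesis.RiemannHypothesis.Theorems.WeilColumnThetaCrossMajorant
import Summits.RiemannHypothesis.RiemannHypothesis.Theorems.WeilColumnThetaLagConvolution
import Summits.RiemannHypothesis.RiemannHypothesis.Theorems.WeilColumnThetaPrimeTailStep
import HarnessLib

/-!
# THETA certificate, tier 2, E4 + E5 assembled: the CROSS TERM `Σ_{n>N} Λ(n)n^{−1/2}·V(log(n/N))` against the kernel's hull (RH-FREE)

Cell `rh-explicit`, WEIL column, seat weil-1 gen21 (cc-s2-1 gen22 TIER2-KERNEL-SPEC §2 «Cross term (E4/E5)», §5 (K4)). Chains the three abstract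
inputs already in the tree — E4-core `integral_mul_sub_le_lagCellSum` (lag-cell convolution bound `H_k`), the majorant `crossMajorant` (step hull
`Gs` below `N e^{W_l}`, analytic tail beyond; `WeilColumnThetaCrossMajorant`), and E5 `sum_Ioc_vonMangoldt_mul_le_of_antitoneOn` (partial summation
against `ψ ≤ C·x` on `[N, ∞)`) — into the ONE inequality the prime side D6′ (`WeilColumnThetaPrimeSideT2`, hypothesis `hX`) consumes:

**`sum_vonMangoldt_cross_le`**: for `e ≥ 0` continuous with `e(s) ≤ Z e^{−(μ+½)s}` (`s ≥ 0`), cell envelopes `e ≤ envX_i` on `[iτ, (i+1)τ]`,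
(K4)-shaped reals `H_k ≥ τ·Σ_{i≤k} envX_i·max(envX_{k−i−1}, envX_{k−i})`, `Gs_k ≥ H_k e^{−kτ/2}` (`k < Kw`), `Gs ≥ 0` non-increasing up to `Kw`,
glue `Z²W_l e^{−(μ+1)W_l} ≤ Gs_{Kw}` (`W_l = Kwτ ≥ 1/(μ+1)`), any `Ve` with `Ve(w) ≤ 0` (`w < 0`) and `Ve(w) ≤ ∫_0^w e(s)e(w−s)ds` (`w ≥ 0`), and
`ψ(x) ≤ C·x` on `[N, ∞)` (`N ≥ 1`): for every `K`,
`Σ_{n<K} Λ(n)/√n·Ve(log n − log N) ≤ C·√N·[Gs 0 + Σ_{k<Kw} Gs_k(e^{(k+1)τ} − e^{kτ}) + Z²e^{−μW_l}(W_l/μ + 1/μ²)]`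
(= the kernel's `cross/(2M₀²)` with `u₁√N = 1`). Nothing here bears on the truth of RH.
-/

noncomputable section

set_option linter.dupNamespace false

open MeasureTheory Set Real Finset
open scoped ArithmeticFunction.vonMangoldt Chebyshev

namespace Summit.RiemannHypothesis.RiemannHypothesis.Theorems.WeilColumn.ThetaPrime

variable {N τ Wl μ Z C : ℝ} {Kw : ℕ} {e Ve : ℝ → ℝ} {envX H Gs : ℕ → ℝ}

/-! ## §1 Two elementary facts on the lag variable `w = log n − log N` -/

/-- For `n > 0`, `N > 0`: `√n = √N·e^{w/2}` with `w = log n − log N`. [folklore] -/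
theorem sqrt_eq_sqrt_mul_exp_half (hN : 0 < N) {x : ℝ} (hx : 0 < x) :
    Real.sqrt x = Real.sqrt N * Real.exp ((Real.log x - Real.log N) / 2) := by
  rw [Real.exp_half, ← Real.sqrt_mul hN.le]
  congr 1
  rw [← Real.log_div hx.ne' hN.ne', Real.exp_log (div_pos hx hN), mul_div_cancel₀ _ hN.ne']

/-- The convolution of the exponential tail with itself: `∫_0^w e(s)e(w−s)ds ≤ Z²·w·e^{−κw}` when `e(s) ≤ Ze^{−κs}` (`s ≥ 0`). [folklore] -/
theorem integral_mul_sub_le_of_expTail {κ w : ℝ} (hec : Continuous e) (he0 : ∀ s, 0 ≤ e s) (hZ : 0 ≤ Z)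
    (hetail : ∀ s, 0 ≤ s → e s ≤ Z * Real.exp (-κ * s)) (hw : 0 ≤ w) :
    ∫ s in (0 : ℝ)..w, e s * e (w - s) ≤ Z ^ 2 * w * Real.exp (-κ * w) := by
  have hint : IntervalIntegrable (fun s ↦ e s * e (w - s)) volume 0 w :=
    (hec.mul (hec.comp (continuous_const.sub continuous_id))).intervalIntegrable _ _
  have hpt : ∀ s ∈ Set.Icc 0 w, e s * e (w - s) ≤ Z ^ 2 * Real.exp (-κ * w) := by
    intro s hs
    have h1 := hetail s hs.1
    have h2 := hetail (w - s) (by linarith [hs.2])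
    have hexp : Real.exp (-κ * s) * Real.exp (-κ * (w - s)) = Real.exp (-κ * w) := by
      rw [← Real.exp_add]; congr 1; ring
    calc e s * e (w - s) ≤ Z * Real.exp (-κ * s) * (Z * Real.exp (-κ * (w - s))) :=
          mul_le_mul h1 h2 (he0 _) (by positivity)
      _ = Z ^ 2 * Real.exp (-κ * w) := by rw [← hexp]; ring
  calc ∫ s in (0 : ℝ)..w, e s * e (w - s) ≤ ∫ s in (0 : ℝ)..w, Z ^ 2 * Real.exp (-κ * w) :=
        intervalIntegral.integral_mono_on hw hint intervalIntegrable_const hpt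
    _ = Z ^ 2 * w * Real.exp (-κ * w) := by rw [intervalIntegral.integral_const, smul_eq_mul]; ring

/-! ## §2 Pointwise domination by the majorant -/

/-- **On a lag cell `k < Kw`** (`0 ≤ w < W_l`): `e^{−w/2}·∫_0^w e(s)e(w−s)ds ≤ Gs_k` with `k = ⌊w/τ⌋`. [TIER2-KERNEL-SPEC §2 E4] -/
theorem exp_mul_integral_le_hull (hτ : 0 < τ) (hWl : Wl = Kw * τ) (hec : Continuous e) (he0 : ∀ s, 0 ≤ e s)
    (henv0 : ∀ i, 0 ≤ envX i) (henv : ∀ (i : ℕ) (t : ℝ), (i : ℝ) * τ ≤ t → t ≤ ((i : ℝ) + 1) * τ → e t ≤ envX i)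
    (hH : ∀ k < Kw, τ * ∑ i ∈ Finset.range (k + 1), envX i * max (envX (k - i - 1)) (envX (k - i)) ≤ H k)
    (hGs : ∀ k < Kw, H k * Real.exp (-(k * τ) / 2) ≤ Gs k) {w : ℝ} (hw0 : 0 ≤ w) (hw : w < Wl) :
    Real.exp (-w / 2) * ∫ s in (0 : ℝ)..w, e s * e (w - s) ≤ Gs ⌊w / τ⌋₊ := by
  set k : ℕ := ⌊w / τ⌋₊ with hk
  have hk1 : (k : ℝ) * τ ≤ w := by
    have := Nat.floor_le (div_nonneg hw0 hτ.le)
    rw [← hk] at this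
    rwa [le_div_iff₀ hτ] at this
  have hk2 : w ≤ ((k : ℝ) + 1) * τ := by
    have := (Nat.lt_floor_add_one (w / τ)).le
    rw [← hk] at this
    rwa [div_le_iff₀ hτ] at this
  have hkK : k < Kw := by
    have h : w / τ < Kw := by rw [div_lt_iff₀ hτ, ← hWl]; exact hw
    exact (Nat.floor_lt (div_nonneg hw0 hτ.le)).2 h
  have hint : IntervalIntegrable (fun s ↦ e s * e (w - s)) volume 0 w :=
    (hec.mul (hec.comp (continuous_const.sub continuous_id))).intervalIntegrable _ _
  have hE4 := integral_mul_sub_le_lagCellSum hτ he0 henv0 henv hk1 hk2 hint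
  have hHk := hH k hkK
  have hH0 : 0 ≤ H k := le_trans (mul_nonneg hτ.le (Finset.sum_nonneg fun i _ ↦
    mul_nonneg (henv0 i) (le_trans (henv0 _) (le_max_right _ _)))) hHk
  have hexp : Real.exp (-w / 2) ≤ Real.exp (-(k * τ) / 2) := Real.exp_le_exp.2 (by linarith)
  calc Real.exp (-w / 2) * ∫ s in (0 : ℝ)..w, e s * e (w - s) ≤ Real.exp (-w / 2) * H k :=
        mul_le_mul_of_nonneg_left (hE4.trans hHk) (Real.exp_pos _).le
    _ ≤ Real.exp (-(k * τ) / 2) * H k := mul_le_mul_of_nonneg_right hexp hH0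
    _ ≤ Gs k := by rw [mul_comm]; exact hGs k hkK

/-- **Pointwise domination**: for a natural `n > N`,
`Λ(n)/√n·Ve(log n − log N) ≤ Λ(n)·crossMajorant N τ Wl μ Z Gs Kw n`. [TIER2-KERNEL-SPEC §2 E4/E5] -/
theorem term_le_majorant (hN : 0 < N) (hτ : 0 < τ) (hWl : Wl = Kw * τ) (hZ : 0 ≤ Z)
    (hec : Continuous e) (he0 : ∀ s, 0 ≤ e s) (hetail : ∀ s, 0 ≤ s → e s ≤ Z * Real.exp (-(μ + 1 / 2) * s))
    (henv0 : ∀ i, 0 ≤ envX i) (henv : ∀ (i : ℕ) (t : ℝ), (i : ℝ) * τ ≤ t → t ≤ ((i : ℝ) + 1) * τ → e t ≤ envX i)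
    (hH : ∀ k < Kw, τ * ∑ i ∈ Finset.range (k + 1), envX i * max (envX (k - i - 1)) (envX (k - i)) ≤ H k)
    (hGs : ∀ k < Kw, H k * Real.exp (-(k * τ) / 2) ≤ Gs k) (hGs0 : ∀ k, 0 ≤ Gs k)
    (hVe : ∀ w, 0 ≤ w → Ve w ≤ ∫ s in (0 : ℝ)..w, e s * e (w - s))
    {n : ℕ} (hn : N < n) :
    (Λ n : ℝ) / Real.sqrt n * Ve (Real.log n - Real.log N) ≤ Λ n * crossMajorant N τ Wl μ Z Gs Kw n := by
  have hn0 : (0 : ℝ) < n := hN.trans hn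
  have hΛ : 0 ≤ (Λ n : ℝ) := ArithmeticFunction.vonMangoldt_nonneg
  set w : ℝ := Real.log n - Real.log N with hw
  have hw0 : 0 ≤ w := by rw [hw]; linarith [Real.log_le_log hN hn.le]
  have hlogdiv : Real.log ((n : ℝ) / N) = w := by rw [hw, Real.log_div hn0.ne' hN.ne']
  have hsqrt : Real.sqrt n = Real.sqrt N * Real.exp (w / 2) := sqrt_eq_sqrt_mul_exp_half hN hn0
  have hsN : 0 < Real.sqrt N := Real.sqrt_pos.2 hN
  have hnexp : (n : ℝ) = N * Real.exp w := by
    rw [hw, Real.exp_sub, Real.exp_log hn0, Real.exp_log hN]; field_simp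
  -- `Λ/√n·Ve ≤ Λ·e^{−w/2}·(∫ e e)/√N`
  have hVI := hVe w hw0
  have h1 : (Λ n : ℝ) / Real.sqrt n * Ve w ≤ Λ n * (Real.exp (-w / 2) * (∫ s in (0 : ℝ)..w, e s * e (w - s)) / Real.sqrt N) := by
    have e1 : (Λ n : ℝ) / Real.sqrt n * Ve w = Λ n * (Real.exp (-w / 2) * Ve w / Real.sqrt N) := by
      rw [hsqrt, show -w / 2 = -(w / 2) by ring, Real.exp_neg]; field_simp
    rw [e1]
    refine mul_le_mul_of_nonneg_left (div_le_div_of_nonneg_right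
      (mul_le_mul_of_nonneg_left hVI (Real.exp_pos _).le) hsN.le) hΛ
  refine h1.trans (mul_le_mul_of_nonneg_left ?_ hΛ)
  -- compare with the majorant, by region
  unfold crossMajorant
  rw [hlogdiv]
  rcases lt_or_ge w Wl with hlt | hge
  · -- lag cell `k < Kw`: the step hull
    have hcell := exp_mul_integral_le_hull (Gs := Gs) hτ hWl hec he0 henv0 henv hH hGs hw0 hlt
    have hk : ⌊w / τ⌋₊ < Kw := (Nat.floor_lt (div_nonneg hw0 hτ.le)).2 (by rw [div_lt_iff₀ hτ, ← hWl]; exact hlt)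
    rw [hullExt_of_lt hk]
    have hind : 0 ≤ (Set.Ici (N * Real.exp Wl)).indicator (crossTail N μ Z) n :=
      Set.indicator_nonneg (fun _ _ ↦ crossTail_nonneg hN hn.le) _
    have := div_le_div_of_nonneg_right hcell hsN.le
    linarith
  · -- beyond `W_l`: the analytic tail
    have hmem : (n : ℝ) ∈ Set.Ici (N * Real.exp Wl) := by
      show N * Real.exp Wl ≤ n
      rw [hnexp]; exact mul_le_mul_of_nonneg_left (Real.exp_le_exp.2 hge) hN.le
    rw [Set.indicator_of_mem hmem]
    have htail := integral_mul_sub_le_of_expTail (κ := μ + 1 / 2) hec he0 hZ hetail hw0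
    have h2 : Real.exp (-w / 2) * (∫ s in (0 : ℝ)..w, e s * e (w - s)) / Real.sqrt N ≤ crossTail N μ Z n := by
      unfold crossTail
      rw [hlogdiv]
      have e2 : Real.exp (-w / 2) * (Z ^ 2 * w * Real.exp (-(μ + 1 / 2) * w)) = Z ^ 2 * w * Real.exp (-(μ + 1) * w) := by
        rw [show Z ^ 2 * w * Real.exp (-(μ + 1) * w) = Z ^ 2 * w * (Real.exp (-w / 2) * Real.exp (-(μ + 1 / 2) * w)) by
          rw [← Real.exp_add]; congr 2; ring]
        ring
      rw [← e2]
      exact div_le_div_of_nonneg_right (mul_le_mul_of_nonneg_left htail (Real.exp_pos _).le) hsN.le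
    have hstep : 0 ≤ hullExt Gs Kw ⌊w / τ⌋₊ / Real.sqrt N := div_nonneg (hullExt_nonneg hGs0 _) hsN.le
    linarith

/-! ## §3 The cross term -/

/-- **E4 + E5 — THE TIER-2 CROSS TERM.** See the module docstring. [TIER2-KERNEL-SPEC §2 E4/E5, §5 (K4); Abel summation] -/
theorem sum_vonMangoldt_cross_le (hN : 1 ≤ N) (hτ : 0 < τ) (hWl : Wl = Kw * τ) (hμ : 0 < μ) (hWl1 : 1 / (μ + 1) ≤ Wl)
    (hZ : 0 ≤ Z) (hC : 0 ≤ C)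
    (hec : Continuous e) (he0 : ∀ s, 0 ≤ e s) (hetail : ∀ s, 0 ≤ s → e s ≤ Z * Real.exp (-(μ + 1 / 2) * s))
    (henv0 : ∀ i, 0 ≤ envX i) (henv : ∀ (i : ℕ) (t : ℝ), (i : ℝ) * τ ≤ t → t ≤ ((i : ℝ) + 1) * τ → e t ≤ envX i)
    (hH : ∀ k < Kw, τ * ∑ i ∈ Finset.range (k + 1), envX i * max (envX (k - i - 1)) (envX (k - i)) ≤ H k)
    (hGs : ∀ k < Kw, H k * Real.exp (-(k * τ) / 2) ≤ Gs k)
    (hGs0 : ∀ k, 0 ≤ Gs k) (hanti : ∀ k, k + 1 ≤ Kw → Gs (k + 1) ≤ Gs k)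
    (hglue : Z ^ 2 * Wl * Real.exp (-(μ + 1) * Wl) ≤ Gs Kw)
    (hVneg : ∀ w, w < 0 → Ve w ≤ 0) (hVe : ∀ w, 0 ≤ w → Ve w ≤ ∫ s in (0 : ℝ)..w, e s * e (w - s))
    (hψ : ∀ x : ℝ, N ≤ x → ψ x ≤ C * x) (K : ℕ) :
    ∑ n ∈ Finset.range K, (Λ n : ℝ) / Real.sqrt n * Ve (Real.log n - Real.log N) ≤
      C * Real.sqrt N * (Gs 0 + ∑ k ∈ Finset.range Kw, Gs k * (Real.exp ((k + 1) * τ) - Real.exp (k * τ)) +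
        Z ^ 2 * Real.exp (-μ * Wl) * (Wl / μ + 1 / μ ^ 2)) := by
  have hN0 : 0 < N := by linarith
  have hμ1 : 0 < μ + 1 := by linarith
  have hWl0 : 0 < Wl := lt_of_lt_of_le (by positivity) hWl1
  have hKw : 0 < Kw := by
    rcases Nat.eq_zero_or_pos Kw with h | h
    · rw [h, Nat.cast_zero, zero_mul] at hWl; linarith
    · exact h
  set F : ℝ → ℝ := crossMajorant N τ Wl μ Z Gs Kw with hF
  have hFanti : AntitoneOn F (Set.Ici N) := crossMajorant_antitoneOn hN0 hτ hWl hμ1 hWl1 hGs0 hanti hglue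
  have hF0 : ∀ x, N ≤ x → 0 ≤ F x := fun x hx ↦ crossMajorant_nonneg hN0 hGs0 hx
  -- the right side is nonnegative
  have hΔ : ∀ k : ℕ, 0 ≤ Gs k * (Real.exp ((k + 1) * τ) - Real.exp (k * τ)) := fun k ↦
    mul_nonneg (hGs0 k) (by nlinarith [Real.exp_lt_exp.2 (show (k : ℝ) * τ < (k + 1) * τ by nlinarith)])
  have hRHS : 0 ≤ C * Real.sqrt N * (Gs 0 + ∑ k ∈ Finset.range Kw, Gs k * (Real.exp ((k + 1) * τ) - Real.exp (k * τ)) +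
      Z ^ 2 * Real.exp (-μ * Wl) * (Wl / μ + 1 / μ ^ 2)) := by
    have := Finset.sum_nonneg fun k (_ : k ∈ Finset.range Kw) ↦ hΔ k
    have := hGs0 0
    positivity
  -- terms with `n ≤ N` are nonpositive, the others are dominated by `Λ(n)F(n)`
  have hVle : ∀ w, w ≤ 0 → Ve w ≤ 0 := by
    intro w hw
    rcases lt_or_eq_of_le hw with h | h
    · exact hVneg w h
    · rw [h]; simpa using hVe 0 le_rfl
  have hsmall : ∀ n : ℕ, (n : ℝ) ≤ N → (Λ n : ℝ) / Real.sqrt n * Ve (Real.log n - Real.log N) ≤ 0 := by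
    intro n hn
    rcases Nat.eq_zero_or_pos n with h0 | hpos
    · subst h0; simp
    have hn0 : (0 : ℝ) < n := by exact_mod_cast hpos
    have hw : Real.log n - Real.log N ≤ 0 := by linarith [Real.log_le_log hn0 hn]
    exact mul_nonpos_of_nonneg_of_nonpos (div_nonneg ArithmeticFunction.vonMangoldt_nonneg (Real.sqrt_nonneg _)) (hVle _ hw)
  have hbig : ∀ n : ℕ, N < n → (Λ n : ℝ) / Real.sqrt n * Ve (Real.log n - Real.log N) ≤ Λ n * F n := fun n hn ↦
    term_le_majorant hN0 hτ hWl hZ hec he0 hetail henv0 henv hH hGs hGs0 hVe hn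
  -- compare the sums
  have hsum : ∑ n ∈ Finset.range K, (Λ n : ℝ) / Real.sqrt n * Ve (Real.log n - Real.log N) ≤
      ∑ n ∈ Finset.Ioc ⌊N⌋₊ K, (Λ n : ℝ) * F n := by
    rw [← Finset.sum_filter_add_sum_filter_not (Finset.range K) (fun n : ℕ ↦ ⌊N⌋₊ < n)]
    have hneg : ∑ n ∈ (Finset.range K).filter (fun n : ℕ ↦ ¬⌊N⌋₊ < n),
        (Λ n : ℝ) / Real.sqrt n * Ve (Real.log n - Real.log N) ≤ 0 :=
      Finset.sum_nonpos fun n hn ↦ by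
        rw [Finset.mem_filter, not_lt] at hn
        exact hsmall n ((Nat.le_floor_iff hN0.le).1 hn.2)
    have hpos : ∑ n ∈ (Finset.range K).filter (fun n : ℕ ↦ ⌊N⌋₊ < n),
        (Λ n : ℝ) / Real.sqrt n * Ve (Real.log n - Real.log N) ≤
        ∑ n ∈ (Finset.range K).filter (fun n : ℕ ↦ ⌊N⌋₊ < n), (Λ n : ℝ) * F n :=
      Finset.sum_le_sum fun n hn ↦ by
        rw [Finset.mem_filter] at hn
        exact hbig n ((Nat.floor_lt hN0.le).1 hn.2)
    have hsub : (Finset.range K).filter (fun n : ℕ ↦ ⌊N⌋₊ < n) ⊆ Finset.Ioc ⌊N⌋₊ K := by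
      intro n hn
      rw [Finset.mem_filter, Finset.mem_range] at hn
      rw [Finset.mem_Ioc]
      exact ⟨hn.2, hn.1.le⟩
    have hext : ∑ n ∈ (Finset.range K).filter (fun n : ℕ ↦ ⌊N⌋₊ < n), (Λ n : ℝ) * F n ≤
        ∑ n ∈ Finset.Ioc ⌊N⌋₊ K, (Λ n : ℝ) * F n :=
      Finset.sum_le_sum_of_subset_of_nonneg hsub fun n hn _ ↦ by
        rw [Finset.mem_Ioc] at hn
        exact mul_nonneg ArithmeticFunction.vonMangoldt_nonneg (hF0 n ((Nat.floor_lt hN0.le).1 hn.1).le)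
    linarith
  refine hsum.trans ?_
  rcases lt_or_ge (K : ℝ) N with hKN | hNK
  · -- no `n > N` below `K`
    rw [Finset.Ioc_eq_empty (fun h ↦ ?_), Finset.sum_empty]
    · exact hRHS
    · exact absurd ((Nat.floor_lt hN0.le).1 h) (not_lt.2 hKN.le)
  · -- E5 + boundary + integral
    have hE5 := sum_Ioc_vonMangoldt_mul_le_of_antitoneOn hN0 hC hψ hFanti hF0 (b := K) hNK
    have hbd : N * F N = Real.sqrt N * Gs 0 := crossMajorant_boundary hN0 hKw hWl0
    have hint := integral_crossMajorant_le (Z := Z) hN0 hτ hWl hμ hGs0 hanti hNK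
    rw [hbd] at hE5
    refine hE5.trans ?_
    have hC' := mul_le_mul_of_nonneg_left hint hC
    linarith [hC']

end Summit.RiemannHypothesis.RiemannHypothesis.Theorems.WeilColumn.ThetaPrime

end
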